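import Summits.SmoothPoincare4.SmoothPoincare4.Theorems.SubcylindricalRecognition.Negative.Shape
import Summits.SmoothPoincare4.SmoothPoincare4.Theorems.SubcylindricalRecognition.Negative.WindowArithmetic
import Literature.Geometry.Riemannian.ShrinkingRoundSphereFour
import HarnessLib

/-!
# `SubcylindricalRecognition` — negative knowledge V: tightness of the entropy hypothesis at the round `S⁴`

Support lemmas for crux `stmt-SmoothPoincare4-10869` (RUNG), from the standing disprover's work file
`Cruxes/SubcylindricalRecognition/Disproof.lean` (§8.3, §8.5), in the crux's own (unfolded) typing of `𝒲`.

* `roundSphere_const_compatible_and_W` — on the unit round `S⁴` (`R = 12`, `Vol = 8π²/3`, both proved in the tree)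
  the constant `f ≡ log 6` is compatible at the shrinker scale `τ = 1/6` and `𝒲(g_{S⁴}, log 6, 1/6) = log 6 − 2`.
* `roundSphere_gap_le` — any threshold-plus-gap `c + δ` that the round `S⁴` clears (shape `Negative.EntropyAbove`)
  is `≤ log 6 − 2`, i.e. `μ(g_{S⁴}, 1/6) ≤ log 6 − 2 = ν_round` holds in the tree's typing (the reverse inequality —
  Perelman (T2) + sharp Bakry–Émery LSI — is the disprover's documented near-miss); `entropyAbove_round_lt`,
  **`not_entropyAbove_round_nuRound`** (the round sphere does NOT clear its own density: raising the crux threshold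
  to `ν_round` loses the model witness), `roundSphere_cruxGap_le` (the crux's `δ` for the round metric is
  `≤ log 6 − 2 − ν_cyl`) and `gap_window` (`0.0258 < log 6 − 2 − ν_cyl < 0.0267`).
References: Cao–Hamilton–Ilmanen arXiv:math/0404165 §4; Perelman arXiv:math/0211159 §3.1.
-/

noncomputable section

set_option linter.dupNamespace false

namespace Summit.SmoothPoincare4.SmoothPoincare4.Theorems.SubcylindricalRecognition.Negative

open scoped Manifold ContDiff Topology ENNReal NNReal
open MeasureTheory Set Literature.Geometry.Lorentzian Literature.Geometry.Riemannian

/-- `𝒲(g_{S⁴(1)}, f ≡ log 6, τ = 1/6) = log 6 − 2` and the constant `log 6` is compatible at `τ = 1/6`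
(`(4π/6)⁻² e^{−log 6} · Vol(S⁴) = (36/16π²)(1/6)(8π²/3) = 1`), in the crux's unfolded typing, for the
unit round metric with `R = 12` (`scalarCurvature_roundMetric`) and `Vol = 8π²/3`
(`riemannianMeasure_roundMetric_sphere_four_univ`). [folklore] -/
theorem roundSphere_const_compatible_and_W :
    (∫ x, (4 * Real.pi * (1 / 6 : ℝ)) ^ (-(4 : ℝ) / 2) * Real.exp (-(fun _ : SphereFour => Real.log 6) x)
        ∂(riemannianMeasure ((roundMetric (n := 4) EuclideanFive).toContMDiffRiemannianMetric
          isRiemannian_roundMetric)) = 1) ∧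
    (∫ x, ((1 / 6 : ℝ) * ((roundMetric (n := 4) EuclideanFive).scalarCurvature x +
          (roundMetric (n := 4) EuclideanFive).gradSq (fun _ : SphereFour => Real.log 6) x) +
          (fun _ : SphereFour => Real.log 6) x - 4) *
        ((4 * Real.pi * (1 / 6 : ℝ)) ^ (-(4 : ℝ) / 2) * Real.exp (-(fun _ : SphereFour => Real.log 6) x))
        ∂(riemannianMeasure ((roundMetric (n := 4) EuclideanFive).toContMDiffRiemannianMetric
          isRiemannian_roundMetric)) = Real.log 6 - 2) := by
  have hvol : (riemannianMeasure ((roundMetric (n := 4) EuclideanFive).toContMDiffRiemannianMetric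
      isRiemannian_roundMetric)).real univ = 8 * Real.pi ^ 2 / 3 := by
    rw [Measure.real, riemannianMeasure_roundMetric_sphere_four_univ EuclideanFive,
      ENNReal.toReal_ofReal (by positivity)]
  have hrpow : (4 * Real.pi * (1 / 6 : ℝ)) ^ (-(4 : ℝ) / 2) = ((4 * Real.pi * (1 / 6)) ^ 2)⁻¹ := by
    rw [show (-(4 : ℝ) / 2) = -(2 : ℝ) by norm_num, Real.rpow_neg (by positivity),
      Real.rpow_two]
  have hexp : Real.exp (-Real.log 6) = 1 / 6 := by
    rw [Real.exp_neg, Real.exp_log (by norm_num)]; ring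
  have hu : (4 * Real.pi * (1 / 6 : ℝ)) ^ (-(4 : ℝ) / 2) * Real.exp (-Real.log 6) =
      (8 * Real.pi ^ 2 / 3)⁻¹ := by
    rw [hrpow, hexp]
    field_simp
    ring
  have hπ := Real.pi_pos
  constructor
  · simp only []
    rw [integral_const, smul_eq_mul, hvol, hu]
    field_simp
  · simp only [scalarCurvature_roundMetric, PseudoRiemannianMetric.gradSq_const]
    rw [integral_const, smul_eq_mul, hvol, hu]
    have h8 : ∀ K : ℝ, 8 * Real.pi ^ 2 / 3 * (K * (8 * Real.pi ^ 2 / 3)⁻¹) = K := fun K => by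
      field_simp
    rw [h8]
    push_cast
    ring

/-- **TIGHTNESS at the round `S⁴`.** If the unit round metric satisfies the crux's entropy clause with
threshold `c` and gap `δ` (`EntropyAbove`-shape, unfolded), then `c + δ ≤ log 6 − 2 = ν_round`: test the
clause at the shrinker scale `τ = 1/6` with the compatible constant `f ≡ log 6`. Hence at the crux's
threshold `c = ν_cyl` the admissible gap is `δ ≤ log 6 − 2 − ν_cyl < 0.0267` (`gap_window`), and NO gap
is admissible at the threshold `ν_round` itself (`not_entropyAbove_round_nuRound`): the usable threshold
window for the round sphere is `[ν_cyl, ν_round)`, of width `< 0.0267` — i.e. `μ(g_{S⁴}, 1/6) ≤ log 6 − 2`,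
so `ν(S⁴_round) ≤ log 6 − 2` holds in the tree's typing (the reverse inequality is the near-miss §5). [folklore] -/
theorem roundSphere_gap_le {c δ : ℝ}
    (h : ∀ τ : ℝ, 0 < τ → ∀ f : SphereFour → ℝ, ContMDiff (𝓡 4) 𝓘(ℝ, ℝ) ∞ f →
      ∫ x, (4 * Real.pi * τ) ^ (-(4 : ℝ) / 2) * Real.exp (-f x)
        ∂(riemannianMeasure ((roundMetric (n := 4) EuclideanFive).toContMDiffRiemannianMetric
          isRiemannian_roundMetric)) = 1 →
      c + δ ≤ ∫ x, (τ * ((roundMetric (n := 4) EuclideanFive).scalarCurvature x +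
          (roundMetric (n := 4) EuclideanFive).gradSq f x) + f x - 4) *
        ((4 * Real.pi * τ) ^ (-(4 : ℝ) / 2) * Real.exp (-f x))
        ∂(riemannianMeasure ((roundMetric (n := 4) EuclideanFive).toContMDiffRiemannianMetric
          isRiemannian_roundMetric))) :
    c + δ ≤ Real.log 6 - 2 := by
  obtain ⟨h1, h2⟩ := roundSphere_const_compatible_and_W
  have := h (1 / 6) (by norm_num) (fun _ => Real.log 6) contMDiff_const h1
  rwa [h2] at this

/-- Any threshold `c` the unit round `S⁴` clears with a positive gap is `< log 6 − 2 = ν_round`. [folklore] -/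
theorem entropyAbove_round_lt {c : ℝ}
    (h : EntropyAbove (roundMetric (n := 4) EuclideanFive) isRiemannian_roundMetric c) :
    c < Real.log 6 - 2 := by
  obtain ⟨δ, hδ, H⟩ := h
  have := roundSphere_gap_le (c := c) (δ := δ) H
  linarith

/-- **The round `S⁴` does NOT clear its own density**: `¬ EntropyAbove g_{S⁴} ν_round`. So the recogniser
`Recognition (log 6 − 2)` (threshold raised to the sphere's value; weaker than the crux, still SPC4-implied,
`recognition_mono`/`spc4_imp_recognition`) has lost its model witness — if the round metric maximises `ν` on
`S⁴` (CHI 2004: it is a local maximum) its hypothesis is vacuous. The usable thresholds are `[ν_cyl, ν_round)`. [folklore] -/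
theorem not_entropyAbove_round_nuRound :
    ¬ EntropyAbove (roundMetric (n := 4) EuclideanFive) isRiemannian_roundMetric (Real.log 6 - 2) :=
  fun h ↦ lt_irrefl _ (entropyAbove_round_lt h)

/-- The crux's gap for the round metric: `δ ≤ log 6 − 2 − ν_cyl` (`< 0.0267`, `gap_window`). [folklore] -/
theorem roundSphere_cruxGap_le {δ : ℝ}
    (h : ∀ τ : ℝ, 0 < τ → ∀ f : SphereFour → ℝ, ContMDiff (𝓡 4) 𝓘(ℝ, ℝ) ∞ f →
      ∫ x, (4 * Real.pi * τ) ^ (-(4 : ℝ) / 2) * Real.exp (-f x)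
        ∂(riemannianMeasure ((roundMetric (n := 4) EuclideanFive).toContMDiffRiemannianMetric
          isRiemannian_roundMetric)) = 1 →
      nuCyl + δ ≤ ∫ x, (τ * ((roundMetric (n := 4) EuclideanFive).scalarCurvature x +
          (roundMetric (n := 4) EuclideanFive).gradSq f x) + f x - 4) *
        ((4 * Real.pi * τ) ^ (-(4 : ℝ) / 2) * Real.exp (-f x))
        ∂(riemannianMeasure ((roundMetric (n := 4) EuclideanFive).toContMDiffRiemannianMetric
          isRiemannian_roundMetric))) :
    δ ≤ Real.log 6 - 2 - nuCyl := by
  have := roundSphere_gap_le (c := nuCyl) (δ := δ) h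
  linarith

/-- **The window of admissible gaps**: `0.0258 < log 6 − 2 − ν_cyl < 0.0267` (true value `.02625`), from
`volRatio_window` (`Θ_cyl/Θ_sph ∈ (.974, .9742)`) and `1 − 1/x ≤ log x ≤ x − 1`. [folklore] -/
theorem gap_window : 0.0258 < Real.log 6 - 2 - nuCyl ∧ Real.log 6 - 2 - nuCyl < 0.0267 := by
  have hc0 : 0 < thetaCyl := by unfold thetaCyl; positivity
  have hs0 : 0 < thetaSph := by unfold thetaSph; positivity
  have hr0 : 0 < thetaCyl / thetaSph := div_pos hc0 hs0
  obtain ⟨hlo, hhi⟩ := volRatio_window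
  have hgap : Real.log 6 - 2 - nuCyl = -Real.log (thetaCyl / thetaSph) := by
    rw [nuCyl_eq_log_thetaCyl, ← log_thetaSph, Real.log_div hc0.ne' hs0.ne']; ring
  rw [hgap]
  constructor
  · have h1 := Real.log_le_sub_one_of_pos hr0
    linarith
  · have h1 := Real.one_sub_inv_le_log_of_pos hr0
    have h2 : (thetaCyl / thetaSph)⁻¹ < (0.974 : ℝ)⁻¹ := by
      rw [inv_lt_inv₀ hr0 (by norm_num)]; exact hlo
    have h3 : (0.974 : ℝ)⁻¹ < 1.0267 := by norm_num
    linarith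

end Summit.SmoothPoincare4.SmoothPoincare4.Theorems.SubcylindricalRecognition.Negative

end
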